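import Literature.MathematicalPhysics.QuantumFieldTheory.Balaban1983to89.T4Hk163StripRate
import Literature.MathematicalPhysics.QuantumFieldTheory.Balaban1983to89.T4GaugeActionRatePair

/-!
# `Balaban1983to89.T4Hk163RatePair` — the (1.63) layer (`H_k`, cell object X10) at `U = 1` SATISFIES the shared T4/β η-rate hypothesis `T4RateAlgebra.RatePair`: (UD) k-uniform exponential decay AND (PR′) the one-step rate `|X_{k+1}(x) − X_k(x)| ≤ C′θ^k e^{−δ|x|₁}` with `θ = L⁻¹`, for the unit-lattice kernels of the coarse multipliers `G_0^{(L^k)}` (cell lane t4-ne2, seat P2, generation 5, companion of `T4Hk163StripRate`)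

HONEST FRAMING (page 1).  Rung (B)+1 bookkeeping for the LINEAR theory, `U = 1`, FINITE tori / the unit lattice `ℤ^{d+1}`;
NOT infinite volume, NOT a mass gap, NOT Clay, NOT summit progress.  This module is a READING of `T4Hk163StripRate` §5 in the
cell's liaison currency: the companion `T4GaugeActionRatePair` (gen 2) proved the rate pair for the (1.66) layer and says in
its header that the shared hypothesis «stays a hypothesis for `H_k`, `G` and everything with background»; here it becomes a
THEOREM for the (1.63) layer `H_k` at `U = 1` — precisely: for the family `k ↦ Re K_0^{(L^k)}` of unit-lattice kernels
(`B4ContourShift.latticeKernel`) of b05's coarse multipliers `G163 (L^k) μ λ 0` (fine offset `a = 0`, i.e. the coarse-point /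
block-origin component; every fixed physical offset is covered by `T4Hk163StripRate.latticeKernel_G163_rate` in the same
way).  It remains a hypothesis for `G` ((1.83)–(1.84), X9) and for everything with background (NE2⁺).

SOURCES (locations of printed TEXT only; nothing printed is a hypothesis — ABSOLUTE RULE): [Balaban1984PropagatorsI] (1.63)
p. 28 (the multiplier; typed by b05 as `B5Hk163Strip.h163` / `B5Hk163Decay.G163`); [King1986] §4 pp. 672–673 (mechanism,
see `T4Hk163StripRate`).  Every declaration is `[folklore]`.

## Content (sorry-free)

* `kerH n μ λ x = Re (latticeKernel (G163 n μ λ 0) x)`; `kerH_decay` ((UD): `|kerH n μ λ x| ≤ MG163(d+1)·e^{−(κ₁₆₃(d+1)/(d+1))|x|₁}`,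
  b05's `latticeKernel_G163_decay` + the sup-to-`ℓ¹` conversion of `T4GaugeActionRatePair` §1); `kerH_step` (the two-level
  bound `|kerH m − kerH n| ≤ CGe(d+1)/n · e^{−(κ₁₆₃(d+1)/(d+1))|x|₁}`, `1 ≤ n ≤ m`, from `latticeKernel_G163_rate`).
* `kerHFamily L μ λ k = kerH (L^k) μ λ`; **`ratePair_kerHFamily`**: `RatePair (kerHFamily L μ λ) (MG163(d+1))
  (κ₁₆₃(d+1)/(d+1)) (CGe(d+1)) (L⁻¹)` for every `L ≥ 1`, `μ`, `λ`; readings `unitStepIneq_kerHFamily` (T4),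
  `uniformDecay_and_stepRate_kerHMatrix` (β, matrix indices = the vector indices `(μ, λ)` of `h_{μλ}`), `kernelInputs163`
  (the β socket structure is inhabited for `L ≥ 2`, `μ ≠ λ` — CAVEAT as in the companion: NOT `Π⁰`, no one-loop statement),
  `exists_ratePair_163`.

Honest scope: `θ = L⁻¹` (rate `η¹`; the (1.66) layer has `θ = L⁻²`, `T4Rate166StripDirect`), constants explicit and crude; the
identification of `kerH` with the kernel of a typed operator `H_k` is consumer bookkeeping (as in `B5Hk163Decay`).
-/

namespace Literature.MathematicalPhysics.QuantumFieldTheory.Balaban1983to89.T4Hk163RatePair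

open Complex
open Literature.MathematicalPhysics.QuantumFieldTheory.Balaban1983to89.B4ContourShift (latticeKernel latticeKernel_decay
  supNorm)
open Literature.MathematicalPhysics.QuantumFieldTheory.Balaban1983to89.B5Hk163Strip (kappa163 kappa163_pos)
open Literature.MathematicalPhysics.QuantumFieldTheory.Balaban1983to89.B5Hk163Decay (G163 MG163 MG163_nonneg
  latticeKernel_G163_decay)
open Literature.MathematicalPhysics.QuantumFieldTheory.Balaban1983to89.T4Hk163StripRate (CGe CGe_nonneg
  latticeKernel_G163_rate)
open Literature.MathematicalPhysics.QuantumFieldTheory.Balaban1983to89.B12Sec2to5 (l1 l1_nonneg Decay510)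
open Literature.MathematicalPhysics.QuantumFieldTheory.Balaban1983to89.T4RateAlgebra (RatePair step step_apply
  UnitStepIneq unitStepIneq_iff ratePair_iff_uniformDecay_and_stepRate kernelInputsOfRatePair)
open Literature.MathematicalPhysics.QuantumFieldTheory.Balaban1983to89.T4GaugeActionRatePair (exp_sup_le_exp_l1
  theta_lt_one theta_nonneg)

noncomputable section

variable {d : ℕ}

/-- `Re K_0^{(n)}(x)`: the real part of the unit-lattice kernel of b05's coarse multiplier `G163 n μ λ 0` of (1.63)
(fine offset `0`). [cite: Balaban1984PropagatorsI, (1.63) p.28] -/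
def kerH (n : ℕ) [NeZero n] (μ lam : Fin (d + 1)) (x : Fin (d + 1) → ℤ) : ℝ :=
  (latticeKernel (fun p : Fin (d + 1) → ℂ => G163 n μ lam (fun _ => (0 : Fin n)) p) x).re

/-- **(UD) for the (1.63) kernels**, every `n ≥ 1`: `|Re K_0^{(n)}(x)| ≤ MG163(d+1)·e^{−(κ₁₆₃(d+1)/(d+1))|x|₁}`
(b05's `latticeKernel_G163_decay` + sup-to-`ℓ¹`). [folklore] -/
theorem kerH_decay (n : ℕ) [NeZero n] (μ lam : Fin (d + 1)) :
    Decay510 (kerH (d := d) n μ lam) (MG163 (d + 1)) (kappa163 (d + 1) / ((d : ℝ) + 1)) := by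
  intro x
  have hκ : 0 ≤ kappa163 (d + 1) := (kappa163_pos (d + 1)).le
  have h1 := latticeKernel_G163_decay (d := d) n μ lam (fun _ => (0 : Fin n)) x
  have h2 := exp_sup_le_exp_l1 (d := d) hκ x
  calc |kerH n μ lam x| ≤ ‖latticeKernel (fun p : Fin (d + 1) → ℂ => G163 n μ lam (fun _ => (0 : Fin n)) p) x‖ := by
          unfold kerH; exact abs_re_le_norm _
    _ ≤ MG163 (d + 1) * Real.exp (-(kappa163 (d + 1) * supNorm x)) := h1
    _ ≤ MG163 (d + 1) * Real.exp (-(kappa163 (d + 1) / ((d : ℝ) + 1)) * l1 x) :=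
        mul_le_mul_of_nonneg_left h2 (MG163_nonneg _)

/-- **the two-level bound** (`T4Hk163StripRate.latticeKernel_G163_rate` at the physical offset `0`): for `1 ≤ n ≤ m`,
`|Re K_0^{(m)}(x) − Re K_0^{(n)}(x)| ≤ CGe(d+1)/n · e^{−(κ₁₆₃(d+1)/(d+1))|x|₁}`. [folklore] -/
theorem kerH_step {n m : ℕ} [NeZero n] [NeZero m] (hn : 1 ≤ n) (hnm : n ≤ m) (μ lam : Fin (d + 1))
    (x : Fin (d + 1) → ℤ) :
    |kerH m μ lam x - kerH n μ lam x|
      ≤ CGe (d + 1) / n * Real.exp (-(kappa163 (d + 1) / ((d : ℝ) + 1)) * l1 x) := by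
  have hκ : 0 ≤ kappa163 (d + 1) := (kappa163_pos (d + 1)).le
  have hr := latticeKernel_G163_rate (d := d) hn hnm μ lam (fun _ => (0 : Fin n)) (fun _ => (0 : Fin m))
    (fun _ => by simp) x
  have h2 := exp_sup_le_exp_l1 (d := d) hκ x
  have hC : 0 ≤ CGe (d + 1) / n := by have := CGe_nonneg (d + 1); positivity
  calc |kerH m μ lam x - kerH n μ lam x|
        = |(latticeKernel (fun p : Fin (d + 1) → ℂ => G163 m μ lam (fun _ => (0 : Fin m)) p) x
            - latticeKernel (fun p : Fin (d + 1) → ℂ => G163 n μ lam (fun _ => (0 : Fin n)) p) x).re| := by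
          simp only [kerH, Complex.sub_re]
    _ ≤ ‖latticeKernel (fun p : Fin (d + 1) → ℂ => G163 m μ lam (fun _ => (0 : Fin m)) p) x
            - latticeKernel (fun p : Fin (d + 1) → ℂ => G163 n μ lam (fun _ => (0 : Fin n)) p) x‖ :=
          abs_re_le_norm _
    _ ≤ CGe (d + 1) / n * Real.exp (-(kappa163 (d + 1) * supNorm x)) := hr
    _ ≤ CGe (d + 1) / n * Real.exp (-(kappa163 (d + 1) / ((d : ℝ) + 1)) * l1 x) :=
          mul_le_mul_of_nonneg_left h2 hC

/-- the scale-indexed family `X_k(x) = Re K_0^{(L^k)}(x)` of the (1.63) layer. [folklore] -/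
def kerHFamily (L : ℕ) [NeZero L] (μ lam : Fin (d + 1)) : ℕ → (Fin (d + 1) → ℤ) → ℝ :=
  fun k x => kerH (L ^ k) μ lam x

/-- **RATE PAIR FOR THE (1.63) LAYER AT `U = 1`**: for every `L ≥ 1`, `μ`, `λ`,
`RatePair (kerHFamily L μ λ) (MG163(d+1)) (κ₁₆₃(d+1)/(d+1)) (CGe(d+1)) (L⁻¹)` — (UD) `|X_k(x)| ≤ MG163·e^{−δ|x|₁}` uniformly
in `k` and (PR′) `|X_{k+1}(x) − X_k(x)| ≤ CGe·L^{−k}·e^{−δ|x|₁}`, `δ = κ₁₆₃(d+1)/(d+1)`.  The shared hypothesis of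
`T4RateAlgebra` is thereby a THEOREM for this family (it stays a hypothesis for `G` and everything with background).
[folklore] -/
theorem ratePair_kerHFamily (L : ℕ) [NeZero L] (μ lam : Fin (d + 1)) :
    RatePair (kerHFamily (d := d) L μ lam) (MG163 (d + 1)) (kappa163 (d + 1) / ((d : ℝ) + 1)) (CGe (d + 1))
      ((L : ℝ)⁻¹) where
  decay k := kerH_decay (d := d) (L ^ k) μ lam
  rate k := by
    intro x
    have hL : 1 ≤ L := Nat.one_le_iff_ne_zero.mpr (NeZero.ne L)
    have h := kerH_step (d := d) (n := L ^ k) (m := L ^ (k + 1)) (Nat.one_le_pow _ _ hL)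
      (Nat.pow_le_pow_right hL (Nat.le_succ k)) μ lam x
    have e : CGe (d + 1) / (((L ^ k : ℕ) : ℝ)) = CGe (d + 1) * ((L : ℝ)⁻¹) ^ k := by
      rw [Nat.cast_pow, inv_pow, div_eq_mul_inv]
    rw [e] at h
    rw [step_apply]
    exact h

/-- T4 reading: `UnitStepIneq` holds for the (1.63) kernels with `B₀ = CGe(d+1)`, `δ₀ = κ₁₆₃(d+1)/(d+1)`, `θ = L⁻¹`.
[folklore] -/
theorem unitStepIneq_kerHFamily (L : ℕ) [NeZero L] (μ lam : Fin (d + 1)) :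
    UnitStepIneq (kerHFamily (d := d) L μ lam) (CGe (d + 1)) (kappa163 (d + 1) / ((d : ℝ) + 1)) ((L : ℝ)⁻¹) :=
  (unitStepIneq_iff _ _ _ _).mpr (ratePair_kerHFamily L μ lam).rate

/-- the same kernels packaged β-style, matrix indices = the vector indices `(μ, λ)` of `h_{μλ}`:
`kerHMatrix L k μ λ x = Re K_0^{(L^k)}_{μλ}(x)`.  NOT the one-loop kernel `Π⁰` of [Balaban1987RG1] (1.22): one PRIMITIVE of
the linear layer. [cite: Balaban1984PropagatorsI, (1.63) p.28] -/
def kerHMatrix (L : ℕ) [NeZero L] : ℕ → B12Beta.Kernel (d + 1) :=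
  fun k μ lam x => kerH (L ^ k) μ lam x

/-- β reading: `UniformDecay ∧ StepRate` of every `(μ, λ)` component of `kerHMatrix L`, constants `MG163(d+1)`,
`κ₁₆₃(d+1)/(d+1)`, `CGe(d+1)`, `θ = L⁻¹`. [folklore] -/
theorem uniformDecay_and_stepRate_kerHMatrix (L : ℕ) [NeZero L] (μ lam : Fin (d + 1)) :
    Beta.LimitRate.UniformDecay (kerHMatrix (d := d) L) μ lam (MG163 (d + 1)) (kappa163 (d + 1) / ((d : ℝ) + 1)) ∧
      Beta.LimitRate.StepRate (kerHMatrix (d := d) L) μ lam (CGe (d + 1)) (kappa163 (d + 1) / ((d : ℝ) + 1))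
        ((L : ℝ)⁻¹) :=
  (ratePair_iff_uniformDecay_and_stepRate (kerHMatrix L) μ lam _ _ _ _).mp (ratePair_kerHFamily L μ lam)

/-- `0 < κ₁₆₃(d+1)/(d+1)`. [folklore] -/
theorem delta163_pos (d : ℕ) : 0 < kappa163 (d + 1) / ((d : ℝ) + 1) := by
  have := kappa163_pos (d + 1); positivity

/-- … hence, for `L ≥ 2` and an off-diagonal vector entry `μ ≠ λ`, the β sub-cell's hypothesis structure
`Beta.LimitRate.KernelInputs (d+1) (kerHMatrix L)` is INHABITED by the (1.63) family (`T4RateAlgebra.kernelInputsOfRatePair`).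
CAVEAT: `KernelInputs` is the socket for the one-loop polarisation kernels `Π⁰_{k+1}`; `kerHMatrix` is NOT `Π⁰`, and no one-loop
dictionary / β-function statement is supplied or implied. [cite: Balaban1987RG1, (1.22) p.264] -/
def kernelInputs163 (L : ℕ) [NeZero L] (hL : 2 ≤ L) {μ lam : Fin (d + 1)} (hμ : μ ≠ lam) :
    Beta.LimitRate.KernelInputs (d + 1) (kerHMatrix (d := d) L) :=
  kernelInputsOfRatePair hμ (delta163_pos d) (theta_nonneg L) (theta_lt_one hL) (ratePair_kerHFamily L μ lam)

/-- Summary in the consumers' quantifier shape: for every `L ≥ 2`, `μ`, `λ` there are `C, δ, C′, θ` — namely `MG163(d+1)`,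
`κ₁₆₃(d+1)/(d+1)`, `CGe(d+1)`, `L⁻¹` — with `0 < δ`, `0 ≤ θ < 1` and the rate pair. [folklore] -/
theorem exists_ratePair_163 (L : ℕ) [NeZero L] (hL : 2 ≤ L) (μ lam : Fin (d + 1)) :
    ∃ C δ C' θ : ℝ, 0 < δ ∧ 0 ≤ θ ∧ θ < 1 ∧ RatePair (kerHFamily (d := d) L μ lam) C δ C' θ :=
  ⟨_, _, _, _, delta163_pos d, theta_nonneg L, theta_lt_one hL, ratePair_kerHFamily L μ lam⟩

end

end Literature.MathematicalPhysics.QuantumFieldTheory.Balaban1983to89.T4Hk163RatePair
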